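import Summits.QuantumFields.YangMills.Theorems.UnitScaleTiltProp7QTwSReality
import HarnessLib

/-!
# Route `UnitScaleTilt` (α), stub EX ∕ node N06(d = 3) layer 0 — **THE TWO SECTORS OF A `ℂ`-LINEAR AVERAGING ON `M₂(ℂ)`-VALUED FIELDS**: from (Q-a) «`𝔰𝔲(2)`-valued ↦
# `𝔰𝔲(2)`-valued» ALONE, a `ℂ`-linear `Q` maps TRACELESS fields to traceless fields and commutes with `X ↦ Xᴴ` ON TRACELESS FIELDS; together with (Q-b) «`Q` commutes with
# `X ↦ Xᴴ` on the SCALAR fields `r·1`, `r` real» it commutes with `X ↦ Xᴴ` on ALL fields — the data row `hQ` of the layer-0 reality assembly; instantiated at `Q := QTwS U₀`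
# with ★w4-20520 g4's ✓`Prop7QTwSReality.QTwS_skewHermitian_traceless_of_regPr` ((Q-a) at `U₀ ∈ 𝔘_k(ε₀)`)

Cell `ym-inputs` (D-0154 (2)), seat ym-inputs-p03 gen 2; the bridge asked for by ★w4-20520 g4 (bus 10:51:06Z, «(iii) `hQ` for `QL2` from the two `QTwS` facts») and located in
`pub/ym-inputs/REALITY-ROWS-LOCATE-p03g2.md` §3.  Count-neutral helper (`--supports stmt-QuantumFields-20520 --as helper`); THEOREMS ONLY (0 `def`, 0 `sorry`).

THE ALGEBRA (pointwise on `M₂(ℂ)`, then `ℂ`-linearity of `Q`).  Every `X ∈ M₂(ℂ)` is `X = S + H` with `S = ½(X − Xᴴ)` skew-Hermitian and `H = ½(X + Xᴴ)` Hermitian, and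
`H = (−i)·(iH)` with `iH` skew-Hermitian; traces: `tr S = ½(tr X − conj tr X)`, so `tr X = 0 ⟹ tr S = tr (iH) = 0`.  Hence for TRACELESS `X`: `Q X = Q S − i·Q(iH)` with both
arguments `𝔰𝔲(2)`-valued, and (Q-a) gives `tr (Q X) = 0` and `(Q X)ᴴ = −Q S − i·(−Q(iH))… = Q(Xᴴ)`.  A general `X` is `X₀ + z·1` (`X₀` traceless, `z = ½ tr X`), `z·1 = (re z)·1 + i·(im z)·1`,
so (Q-b) on the two REAL scalar fields finishes `Q(Xᴴ) = (Q X)ᴴ`.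

WHAT IS PROVED (for ANY `ℂ`-linear `Q : (ι → M₂(ℂ)) →L[ℂ] (κ → M₂(ℂ))`; then at `QTwS U₀`).
* §1 ★`trace_apply_eq_zero_of_su2` — (Q-a) ⟹ `Q` maps traceless fields to traceless fields; ★`star_apply_of_su2_of_traceless` — (Q-a) ⟹ `(Q X c)ᴴ = Q (Xᴴ) c` for traceless `X`.
* §2 ★★`star_apply_of_su2_of_scalar` — (Q-a) + (Q-b) ⟹ `(Q X c)ᴴ = Q (Xᴴ) c` for every `X`; ★★`map_star_of_su2_of_scalar` — the function form `Q (star X) = star (Q X)` (= the row `hQ` of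
  ✓`Prop7SectET3HilbertLettersReality.QL2_star_comm_of` ∕ ★w4-20520 g4's `…SectET3PropagatorsReality`).
  `star_apply_scalar_of_realScalar`, `apply_scalar_of_realScalar`, ★★`map_star_of_su2_of_realScalar`, `sectors_of_su2_of_realScalar` — the scalar row in ONE form (Q-b)ʳ «real scalar
  fields ↦ real scalar fields» yields both the star form and the `∃ d` (complex scalar ↦ scalar) form.
* §3 at `Q := QTwS F n K h U₀`, `U₀ ∈ 𝔘_k(ε₀)` in the windows `10⁹L²e ≤ 1`, `10¹²L³ε₀ ≤ 1`: ★★`trace_QTwS_eq_zero_of_regPr` (traceless ↦ traceless, NO scalar hypothesis),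
  ★★★`QTwS_star_comm_of_regPr_of_scalar` ∕ ★★★`QTwS_star_comm_of_regPr_of_realScalar` (`QTwS U₀ (star X) = star (QTwS U₀ X)` from the ONE displayed scalar-sector row, star resp. real form),
  `QTwS_scalar_of_realScalar` (the `∃ d` form for the trace halves).
HONEST SCOPE: matrix algebra + `ℂ`-linearity; (Q-b) (the centre-equivariance of the exp-mean-log tower) stays DISPLAYED; nothing of [B9]∕[B11]'s estimates; N06(d = 3) NOT discharged;
no claim on EX, the crux, d = 4 or the gap; YM₃ on T³ = rung R3 (RECORD), not Clay.  L-FLOOR: none.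

References: T. Bałaban, CMP **102** (1985) 277–309 [Balaban1985Variational] ((51) p.286 «for A′ with values in 𝔤 the configuration D(A′) has values in 𝔤 also»); CMP **99** (1985)
389–434 [Balaban1985BackgroundPropagators] ((3.13)–(3.14) p.393, «complexified Lie algebra»).
-/

set_option autoImplicit false

noncomputable section

open scoped Matrix.Norms.L2Operator ComplexConjugate

namespace Summit.QuantumFields.YangMills.Theorems.Prop7QTwSRealitySectors

open Literature.MathematicalPhysics.QuantumFieldTheory.Balaban1983to89
open Literature.MathematicalPhysics.QuantumFieldTheory.Balaban1983to89.T3ContinuumYM3Torus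
open T3PrintedRegularMinimiser (RegPr)
open Summit.QuantumFields.YangMills.Theorems.Prop7SymAvgTwSym (QTwS)
open Summit.QuantumFields.YangMills.Theorems.Prop7QTwSReality (QTwS_skewHermitian_traceless_of_regPr)

/-! ## §1 Traceless fields, from (Q-a) alone -/

section Generic

variable {ι κ : Type*} (Q : (ι → Matrix (Fin 2) (Fin 2) ℂ) →L[ℂ] (κ → Matrix (Fin 2) (Fin 2) ℂ))

/-- the skew-Hermitian part `½(X − Xᴴ)` of a traceless field is `𝔰𝔲(2)`-valued. [cite: Balaban1985BackgroundPropagators, p.393] -/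
private theorem skewPart_su2 (A : ι → Matrix (Fin 2) (Fin 2) ℂ) (hA : ∀ b, (A b).trace = 0) (b : ι) :
    star (((1 / 2 : ℂ)) • (A b - star (A b))) = -(((1 / 2 : ℂ)) • (A b - star (A b))) ∧ (((1 / 2 : ℂ)) • (A b - star (A b))).trace = 0 := by
  refine ⟨?_, ?_⟩
  · rw [star_smul, star_sub, star_star, ← smul_neg, neg_sub]
    congr 1
    rw [Complex.star_def, map_div₀, map_one, map_ofNat]
  · rw [Matrix.trace_smul, Matrix.trace_sub, Matrix.star_eq_conjTranspose, Matrix.trace_conjTranspose, hA, star_zero, sub_zero, smul_zero]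

/-- `i` times the Hermitian part `½(X + Xᴴ)` of a traceless field is `𝔰𝔲(2)`-valued. [cite: Balaban1985BackgroundPropagators, p.393] -/
private theorem I_hermPart_su2 (A : ι → Matrix (Fin 2) (Fin 2) ℂ) (hA : ∀ b, (A b).trace = 0) (b : ι) :
    star ((Complex.I * (1 / 2 : ℂ)) • (A b + star (A b))) = -((Complex.I * (1 / 2 : ℂ)) • (A b + star (A b))) ∧
      (((Complex.I * (1 / 2 : ℂ)) • (A b + star (A b)))).trace = 0 := by
  refine ⟨?_, ?_⟩
  · rw [star_smul, star_add, star_star, add_comm (star (A b)), ← neg_smul]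
    congr 1
    rw [Complex.star_def, map_mul, Complex.conj_I, map_div₀, map_one, map_ofNat, neg_mul]
  · rw [Matrix.trace_smul, Matrix.trace_add, Matrix.star_eq_conjTranspose, Matrix.trace_conjTranspose, hA, star_zero, add_zero, smul_zero]

/-- the decomposition `X = ½(X − Xᴴ) + (−i)·(i·½(X + Xᴴ))` as fields. [folklore] -/
private theorem decomp_traceless (A : ι → Matrix (Fin 2) (Fin 2) ℂ) :
    A = (fun b => ((1 / 2 : ℂ)) • (A b - star (A b))) + (-Complex.I) • (fun b => (Complex.I * (1 / 2 : ℂ)) • (A b + star (A b))) := by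
  funext b
  simp only [Pi.add_apply, Pi.smul_apply, smul_smul]
  rw [show -Complex.I * (Complex.I * (1 / 2 : ℂ)) = (1 / 2 : ℂ) by rw [← mul_assoc, neg_mul, Complex.I_mul_I, neg_neg, one_mul]]
  module

/-- ★ **(Q-a) ⟹ `Q` MAPS TRACELESS FIELDS TO TRACELESS FIELDS** (`𝔰𝔩(2,ℂ) = 𝔰𝔲(2) ⊕ i𝔰𝔲(2)` and `ℂ`-linearity). [cite: Balaban1985Variational, (51) p.286; Balaban1985BackgroundPropagators, p.393] -/
theorem trace_apply_eq_zero_of_su2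
    (hsu : ∀ A : ι → Matrix (Fin 2) (Fin 2) ℂ, (∀ b, star (A b) = -A b ∧ (A b).trace = 0) → ∀ c, star (Q A c) = -Q A c ∧ (Q A c).trace = 0)
    (A : ι → Matrix (Fin 2) (Fin 2) ℂ) (hA : ∀ b, (A b).trace = 0) (c : κ) : (Q A c).trace = 0 := by
  have h1 := (hsu _ (skewPart_su2 A hA) c).2
  have h2 := (hsu _ (I_hermPart_su2 A hA) c).2
  rw [decomp_traceless A, map_add, map_smul, Pi.add_apply, Pi.smul_apply, Matrix.trace_add, Matrix.trace_smul, h1, h2, smul_zero, add_zero]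

/-- ★ **(Q-a) ⟹ `(Q X c)ᴴ = Q (Xᴴ) c` FOR TRACELESS `X`.** [cite: Balaban1985Variational, (51) p.286; Balaban1985BackgroundPropagators, p.393] -/
theorem star_apply_of_su2_of_traceless
    (hsu : ∀ A : ι → Matrix (Fin 2) (Fin 2) ℂ, (∀ b, star (A b) = -A b ∧ (A b).trace = 0) → ∀ c, star (Q A c) = -Q A c ∧ (Q A c).trace = 0)
    (A : ι → Matrix (Fin 2) (Fin 2) ℂ) (hA : ∀ b, (A b).trace = 0) (c : κ) : star (Q A c) = Q (star A) c := by
  have h1 := (hsu _ (skewPart_su2 A hA) c).1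
  have h2 := (hsu _ (I_hermPart_su2 A hA) c).1
  -- `Xᴴ` has the same two parts with signs `(−, +)`: `Xᴴ = −S + (−i)(iH)` where `S`, `iH` are the parts of `X`
  have hstar : star A = -(fun b => ((1 / 2 : ℂ)) • (A b - star (A b))) + (-Complex.I) • (fun b => (Complex.I * (1 / 2 : ℂ)) • (A b + star (A b))) := by
    funext b
    simp only [Pi.add_apply, Pi.neg_apply, Pi.smul_apply, Pi.star_apply, smul_smul]
    rw [show -Complex.I * (Complex.I * (1 / 2 : ℂ)) = (1 / 2 : ℂ) by rw [← mul_assoc, neg_mul, Complex.I_mul_I, neg_neg, one_mul]]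
    module
  conv_lhs => rw [decomp_traceless A]
  rw [hstar, map_add, map_smul, map_add, map_neg, map_smul, Pi.add_apply, Pi.smul_apply, Pi.add_apply, Pi.neg_apply, Pi.smul_apply, star_add, star_smul, h1, h2,
    Complex.star_def, map_neg, Complex.conj_I, neg_neg, smul_neg, neg_smul]

/-! ## §2 All fields, from (Q-a) and the scalar sector (Q-b) -/

/-- the traceless part `X − (½ tr X)·1` is traceless (`tr 1 = 2` on `M₂`). [folklore] -/
private theorem trace_sub_half_trace (X : Matrix (Fin 2) (Fin 2) ℂ) : (X - ((1 / 2 : ℂ) * X.trace) • (1 : Matrix (Fin 2) (Fin 2) ℂ)).trace = 0 := by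
  rw [Matrix.trace_sub, Matrix.trace_smul, Matrix.trace_one, Fintype.card_fin, smul_eq_mul]
  push_cast
  ring

/-- ★★ **(Q-a) + (Q-b) ⟹ `(Q X c)ᴴ = Q (Xᴴ) c` FOR EVERY `X`** — (Q-b) in the weak form «`Q` commutes with `X ↦ Xᴴ` on the REAL scalar fields `r·1`» (real scalar fields with real
scalar images satisfy it).  `X = X₀ + (re z)·1 + i·(im z)·1`, `z = ½ tr X`, `X₀` traceless. [cite: Balaban1985Variational, (51) p.286; Balaban1985BackgroundPropagators, p.393] -/
theorem star_apply_of_su2_of_scalar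
    (hsu : ∀ A : ι → Matrix (Fin 2) (Fin 2) ℂ, (∀ b, star (A b) = -A b ∧ (A b).trace = 0) → ∀ c, star (Q A c) = -Q A c ∧ (Q A c).trace = 0)
    (hsc : ∀ r : ι → ℝ, ∀ c, star (Q (fun b => ((r b : ℝ) : ℂ) • (1 : Matrix (Fin 2) (Fin 2) ℂ)) c) = Q (fun b => ((r b : ℝ) : ℂ) • (1 : Matrix (Fin 2) (Fin 2) ℂ)) c)
    (A : ι → Matrix (Fin 2) (Fin 2) ℂ) (c : κ) : star (Q A c) = Q (star A) c := by
  -- the three pieces of `A`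
  set A₀ : ι → Matrix (Fin 2) (Fin 2) ℂ := fun b => A b - ((1 / 2 : ℂ) * (A b).trace) • 1 with hA₀
  set x : ι → ℝ := fun b => ((1 / 2 : ℂ) * (A b).trace).re with hx
  set y : ι → ℝ := fun b => ((1 / 2 : ℂ) * (A b).trace).im with hy
  have hA₀t : ∀ b, (A₀ b).trace = 0 := fun b => trace_sub_half_trace (A b)
  have hdec : A = A₀ + (fun b => ((x b : ℝ) : ℂ) • (1 : Matrix (Fin 2) (Fin 2) ℂ)) + Complex.I • (fun b => ((y b : ℝ) : ℂ) • (1 : Matrix (Fin 2) (Fin 2) ℂ)) := by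
    funext b
    simp only [Pi.add_apply, Pi.smul_apply, hA₀, hx, hy, smul_smul]
    have hz : ((((1 / 2 : ℂ) * (A b).trace).re : ℂ)) = (1 / 2 : ℂ) * (A b).trace - Complex.I * ((((1 / 2 : ℂ) * (A b).trace).im : ℂ)) := by
      rw [eq_sub_iff_add_eq, mul_comm Complex.I]
      exact Complex.re_add_im _
    rw [hz]
    module
  have hdec' : star A = star A₀ + (fun b => ((x b : ℝ) : ℂ) • (1 : Matrix (Fin 2) (Fin 2) ℂ)) + (-Complex.I) • (fun b => ((y b : ℝ) : ℂ) • (1 : Matrix (Fin 2) (Fin 2) ℂ)) := by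
    conv_lhs => rw [hdec]
    funext b
    simp only [Pi.add_apply, Pi.smul_apply, Pi.star_apply, star_add, star_smul, star_one, Complex.star_def, Complex.conj_ofReal, Complex.conj_I]
  rw [hdec', map_add, map_add, map_smul, Pi.add_apply, Pi.add_apply, Pi.smul_apply]
  conv_lhs => rw [hdec, map_add, map_add, map_smul, Pi.add_apply, Pi.add_apply, Pi.smul_apply, star_add, star_add, star_smul,
    star_apply_of_su2_of_traceless Q hsu A₀ hA₀t c, hsc x c, hsc y c, Complex.star_def, Complex.conj_I]

/-- ★★ **THE FUNCTION FORM: `Q (star X) = star (Q X)`** from (Q-a) and the scalar-sector row (Q-b) — the data row `hQ` of the layer-0 reality assembly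
(✓`Prop7SectET3HilbertLettersReality.QL2_star_comm_of`, ★w4-20520 g4's `…SectET3PropagatorsReality`). [cite: Balaban1985Variational, (51) p.286; Balaban1985BackgroundPropagators, p.393] -/
theorem map_star_of_su2_of_scalar
    (hsu : ∀ A : ι → Matrix (Fin 2) (Fin 2) ℂ, (∀ b, star (A b) = -A b ∧ (A b).trace = 0) → ∀ c, star (Q A c) = -Q A c ∧ (Q A c).trace = 0)
    (hsc : ∀ r : ι → ℝ, ∀ c, star (Q (fun b => ((r b : ℝ) : ℂ) • (1 : Matrix (Fin 2) (Fin 2) ℂ)) c) = Q (fun b => ((r b : ℝ) : ℂ) • (1 : Matrix (Fin 2) (Fin 2) ℂ)) c)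
    (A : ι → Matrix (Fin 2) (Fin 2) ℂ) : Q (star A) = star (Q A) :=
  funext fun c => by rw [Pi.star_apply, star_apply_of_su2_of_scalar Q hsu hsc A c]

/-! ### The scalar-sector row in ONE form: real scalar fields ↦ real scalar fields -/

/-- **(Q-b), REAL FORM ⟹ THE STAR FORM**: if `Q` maps every real scalar field `r·1` to a real scalar field `s·1`, then `Q` commutes with `X ↦ Xᴴ` on the real scalar fields
(`(s·1)ᴴ = s·1`). [cite: Balaban1985Variational, (51) p.286; Balaban1985BackgroundPropagators, p.393] -/
theorem star_apply_scalar_of_realScalar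
    (hscR : ∀ r : ι → ℝ, ∃ s : κ → ℝ, Q (fun b => ((r b : ℝ) : ℂ) • (1 : Matrix (Fin 2) (Fin 2) ℂ)) = fun c => ((s c : ℝ) : ℂ) • (1 : Matrix (Fin 2) (Fin 2) ℂ))
    (r : ι → ℝ) (c : κ) :
    star (Q (fun b => ((r b : ℝ) : ℂ) • (1 : Matrix (Fin 2) (Fin 2) ℂ)) c) = Q (fun b => ((r b : ℝ) : ℂ) • (1 : Matrix (Fin 2) (Fin 2) ℂ)) c := by
  obtain ⟨s, hs⟩ := hscR r
  rw [hs, star_smul, star_one, Complex.star_def, Complex.conj_ofReal]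

/-- **(Q-b), REAL FORM ⟹ THE COMPLEX FORM**: `Q` maps every complex scalar field `c·1` to a scalar field (`c = re c + i·im c` pointwise, `ℂ`-linearity) — the `∃ d` shape of
★w4-20520 g4's trace-half assembly. [cite: Balaban1985Variational, (51) p.286; Balaban1985BackgroundPropagators, p.393] -/
theorem apply_scalar_of_realScalar
    (hscR : ∀ r : ι → ℝ, ∃ s : κ → ℝ, Q (fun b => ((r b : ℝ) : ℂ) • (1 : Matrix (Fin 2) (Fin 2) ℂ)) = fun c => ((s c : ℝ) : ℂ) • (1 : Matrix (Fin 2) (Fin 2) ℂ))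
    (z : ι → ℂ) : ∃ d : κ → ℂ, Q (fun b => z b • (1 : Matrix (Fin 2) (Fin 2) ℂ)) = fun c => d c • (1 : Matrix (Fin 2) (Fin 2) ℂ) := by
  obtain ⟨s₁, hs₁⟩ := hscR (fun b => (z b).re)
  obtain ⟨s₂, hs₂⟩ := hscR (fun b => (z b).im)
  refine ⟨fun c => ((s₁ c : ℝ) : ℂ) + Complex.I * ((s₂ c : ℝ) : ℂ), ?_⟩
  have hz : (fun b => z b • (1 : Matrix (Fin 2) (Fin 2) ℂ)) =
      (fun b => (((z b).re : ℝ) : ℂ) • (1 : Matrix (Fin 2) (Fin 2) ℂ)) + Complex.I • (fun b => (((z b).im : ℝ) : ℂ) • (1 : Matrix (Fin 2) (Fin 2) ℂ)) := by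
    funext b
    simp only [Pi.add_apply, Pi.smul_apply, smul_smul, ← add_smul]
    congr 1
    rw [mul_comm Complex.I]
    exact (Complex.re_add_im (z b)).symm
  rw [hz, map_add, map_smul, hs₁, hs₂]
  funext c
  simp only [Pi.add_apply, Pi.smul_apply, smul_smul, ← add_smul]

/-- ★★ **(Q-a) + (Q-b) IN THE REAL FORM ⟹ `Q (star X) = star (Q X)` for every `X`.** [cite: Balaban1985Variational, (51) p.286; Balaban1985BackgroundPropagators, p.393] -/
theorem map_star_of_su2_of_realScalar
    (hsu : ∀ A : ι → Matrix (Fin 2) (Fin 2) ℂ, (∀ b, star (A b) = -A b ∧ (A b).trace = 0) → ∀ c, star (Q A c) = -Q A c ∧ (Q A c).trace = 0)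
    (hscR : ∀ r : ι → ℝ, ∃ s : κ → ℝ, Q (fun b => ((r b : ℝ) : ℂ) • (1 : Matrix (Fin 2) (Fin 2) ℂ)) = fun c => ((s c : ℝ) : ℂ) • (1 : Matrix (Fin 2) (Fin 2) ℂ))
    (A : ι → Matrix (Fin 2) (Fin 2) ℂ) : Q (star A) = star (Q A) :=
  map_star_of_su2_of_scalar Q hsu (star_apply_scalar_of_realScalar Q hscR) A

/-- ★ **(Q-a) + (Q-b) IN THE REAL FORM ⟹ `Q` MAPS SCALAR FIELDS TO SCALAR FIELDS AND TRACELESS FIELDS TO TRACELESS FIELDS** — i.e. `Q` respects BOTH sectors of `M₂(ℂ) = 𝔰𝔩₂ ⊕ ℂ·1`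
(the pair consumed by the unitary-kind ∕ reflection road of the trace halves). [cite: Balaban1985Variational, (51) p.286; Balaban1985BackgroundPropagators, p.393] -/
theorem sectors_of_su2_of_realScalar
    (hsu : ∀ A : ι → Matrix (Fin 2) (Fin 2) ℂ, (∀ b, star (A b) = -A b ∧ (A b).trace = 0) → ∀ c, star (Q A c) = -Q A c ∧ (Q A c).trace = 0)
    (hscR : ∀ r : ι → ℝ, ∃ s : κ → ℝ, Q (fun b => ((r b : ℝ) : ℂ) • (1 : Matrix (Fin 2) (Fin 2) ℂ)) = fun c => ((s c : ℝ) : ℂ) • (1 : Matrix (Fin 2) (Fin 2) ℂ)) :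
    (∀ A : ι → Matrix (Fin 2) (Fin 2) ℂ, (∀ b, (A b).trace = 0) → ∀ c, (Q A c).trace = 0) ∧
      (∀ z : ι → ℂ, ∃ d : κ → ℂ, Q (fun b => z b • (1 : Matrix (Fin 2) (Fin 2) ℂ)) = fun c => d c • (1 : Matrix (Fin 2) (Fin 2) ℂ)) :=
  ⟨fun A hA c => trace_apply_eq_zero_of_su2 Q hsu A hA c, fun z => apply_scalar_of_realScalar Q hscR z⟩

end Generic

/-! ## §3 At `Q := QTwS U₀`, `U₀ ∈ 𝔘_k(ε₀)` -/

section AtQTwS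

variable (F : T3Family) {n K : ℕ} (h : n ≤ K)

/-- ★★ **`QTwS U₀` MAPS TRACELESS FINE FIELDS TO TRACELESS BLOCK FIELDS** at `U₀ ∈ 𝔘_k(ε₀)` in the windows — (Q-a) ✓`QTwS_skewHermitian_traceless_of_regPr` alone, NO scalar hypothesis.
[cite: Balaban1985Variational, (51) p.286; Balaban1985BackgroundPropagators, (3.14) p.393] -/
theorem trace_QTwS_eq_zero_of_regPr [Fact (0 < (F.L : ℝ))] [Fact (0 < ((F.L : ℝ)⁻¹) ^ (K - n))]
    {ε₀ e : ℝ} (hε₀ : 0 < ε₀) (he : 0 < e) (hWe : 10 ^ 9 * (F.L : ℝ) ^ 2 * e ≤ 1) (hWε : 10 ^ 12 * (F.L : ℝ) ^ 3 * ε₀ ≤ 1)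
    (U₀ : GaugeField (F.P K) 0 (Matrix.specialUnitaryGroup (Fin 2) ℂ)) (hreg : RegPr F n K ε₀ U₀)
    (A : PBond (F.P K) 0 → Matrix (Fin 2) (Fin 2) ℂ) (hA : ∀ b, (A b).trace = 0) (c : PBond (F.P n) 0) : (QTwS F n K h U₀ A c).trace = 0 :=
  trace_apply_eq_zero_of_su2 (QTwS F n K h U₀) (fun A hA c => QTwS_skewHermitian_traceless_of_regPr F h hε₀ he hWe hWε U₀ hreg A hA c) A hA c

/-- ★★★ **`QTwS U₀ (Xᴴ) = (QTwS U₀ X)ᴴ` FOR EVERY FINE FIELD `X`** at `U₀ ∈ 𝔘_k(ε₀)` in the windows, from (Q-a) (PROVED, ★w4-20520 g4) and the ONE displayed scalar-sector row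
(Q-b) «`QTwS U₀` commutes with `X ↦ Xᴴ` on the real scalar fields `r·1`» (the centre-equivariance of the exp-mean-log tower; memo `REALITY-ROWS-LOCATE-p03g2.md` §3).
[cite: Balaban1985Variational, (51) p.286; Balaban1985BackgroundPropagators, (3.13)–(3.14) p.393] -/
theorem QTwS_star_comm_of_regPr_of_scalar [Fact (0 < (F.L : ℝ))] [Fact (0 < ((F.L : ℝ)⁻¹) ^ (K - n))]
    {ε₀ e : ℝ} (hε₀ : 0 < ε₀) (he : 0 < e) (hWe : 10 ^ 9 * (F.L : ℝ) ^ 2 * e ≤ 1) (hWε : 10 ^ 12 * (F.L : ℝ) ^ 3 * ε₀ ≤ 1)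
    (U₀ : GaugeField (F.P K) 0 (Matrix.specialUnitaryGroup (Fin 2) ℂ)) (hreg : RegPr F n K ε₀ U₀)
    (hsc : ∀ r : PBond (F.P K) 0 → ℝ, ∀ c, star (QTwS F n K h U₀ (fun b => ((r b : ℝ) : ℂ) • (1 : Matrix (Fin 2) (Fin 2) ℂ)) c) =
      QTwS F n K h U₀ (fun b => ((r b : ℝ) : ℂ) • (1 : Matrix (Fin 2) (Fin 2) ℂ)) c)
    (A : PBond (F.P K) 0 → Matrix (Fin 2) (Fin 2) ℂ) : QTwS F n K h U₀ (star A) = star (QTwS F n K h U₀ A) :=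
  map_star_of_su2_of_scalar (QTwS F n K h U₀) (fun A hA c => QTwS_skewHermitian_traceless_of_regPr F h hε₀ he hWe hWε U₀ hreg A hA c) hsc A

/-- ★★★ **THE ONE DISPLAYED SCALAR ROW, REAL FORM ⟹ `QTwS U₀ (Xᴴ) = (QTwS U₀ X)ᴴ`** at `U₀ ∈ 𝔘_k(ε₀)` in the windows: (Q-b)ʳ «`QTwS U₀` maps real scalar fields `r·1` to real scalar fields» is
the centre-equivariance of the exp-mean-log tower with its REAL averaging weights (memo §3; ★w5-20520 lineage) — the spelling this cell proposes as THE displayed row, since it yields both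
the star form (this theorem) and ★w4-20520 g4's `∃ d` form (`QTwS_scalar_of_regPr_of_realScalar`). [cite: Balaban1985Variational, (51) p.286; Balaban1985BackgroundPropagators, (3.13)–(3.14) p.393] -/
theorem QTwS_star_comm_of_regPr_of_realScalar [Fact (0 < (F.L : ℝ))] [Fact (0 < ((F.L : ℝ)⁻¹) ^ (K - n))]
    {ε₀ e : ℝ} (hε₀ : 0 < ε₀) (he : 0 < e) (hWe : 10 ^ 9 * (F.L : ℝ) ^ 2 * e ≤ 1) (hWε : 10 ^ 12 * (F.L : ℝ) ^ 3 * ε₀ ≤ 1)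
    (U₀ : GaugeField (F.P K) 0 (Matrix.specialUnitaryGroup (Fin 2) ℂ)) (hreg : RegPr F n K ε₀ U₀)
    (hscR : ∀ r : PBond (F.P K) 0 → ℝ, ∃ s : PBond (F.P n) 0 → ℝ,
      QTwS F n K h U₀ (fun b => ((r b : ℝ) : ℂ) • (1 : Matrix (Fin 2) (Fin 2) ℂ)) = fun c => ((s c : ℝ) : ℂ) • (1 : Matrix (Fin 2) (Fin 2) ℂ))
    (A : PBond (F.P K) 0 → Matrix (Fin 2) (Fin 2) ℂ) : QTwS F n K h U₀ (star A) = star (QTwS F n K h U₀ A) :=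
  map_star_of_su2_of_realScalar (QTwS F n K h U₀) (fun A hA c => QTwS_skewHermitian_traceless_of_regPr F h hε₀ he hWe hWε U₀ hreg A hA c) hscR A

/-- **THE `∃ d` FORM OF THE SCALAR ROW FROM ITS REAL FORM** (for ★w4-20520 g4's trace-half assembly): `QTwS U₀` maps every complex scalar field to a scalar field. No window needed (pure
`ℂ`-linearity). [cite: Balaban1985Variational, (51) p.286; Balaban1985BackgroundPropagators, (3.14) p.393] -/
theorem QTwS_scalar_of_realScalar (U₀ : GaugeField (F.P K) 0 (Matrix.specialUnitaryGroup (Fin 2) ℂ))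
    (hscR : ∀ r : PBond (F.P K) 0 → ℝ, ∃ s : PBond (F.P n) 0 → ℝ,
      QTwS F n K h U₀ (fun b => ((r b : ℝ) : ℂ) • (1 : Matrix (Fin 2) (Fin 2) ℂ)) = fun c => ((s c : ℝ) : ℂ) • (1 : Matrix (Fin 2) (Fin 2) ℂ))
    (z : PBond (F.P K) 0 → ℂ) :
    ∃ d : PBond (F.P n) 0 → ℂ, QTwS F n K h U₀ (fun b => z b • (1 : Matrix (Fin 2) (Fin 2) ℂ)) = fun c => d c • (1 : Matrix (Fin 2) (Fin 2) ℂ) :=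
  apply_scalar_of_realScalar (QTwS F n K h U₀) hscR z

end AtQTwS

end Summit.QuantumFields.YangMills.Theorems.Prop7QTwSRealitySectors

end
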